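import Mathlib
import Summits.ResolutionOfSingularities.ResolutionOfSingularities.Theorems.RadicialJungCleanModelsCleanPermissibleSeq
import Summits.ResolutionOfSingularities.ResolutionOfSingularities.Theorems.RadicialJungCleanModelsCleanPointBlowupChartFormOne
import HarnessLib

/-!
# Route `RadicialJung`, crux `CleanModels` (stmt-ResolutionOfSingularities-15917), line `Sketch` rev 18, stub 4e
# `stub_cleanPrincipalization3`: toward L7b (permissibilization of a regular curve by point blow-ups) — the local CONTACT STEP

Lens-5 L7b / memo `Cruxes/CleanModels/Lines/Sketch-memo-4e-cleanPermissible.md` §3, phase 1, in the ABSTRACT CHART DATA of a point blow-up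
(`RadicialJungCleanModelsCleanPointBlowupChart.lean`: regular local `R` with regular system of parameters `t : Fin d → R`, chart `t_j`, `A ⊇ ψ(R)`,
fractions `u_i` with `ψ(t_i) = ψ(t_j) u_i`, `ε : κ[T_i]_{i≠j} ≅ A/(ψ t_j)`, prime `𝔓` over `𝔪`, `L = A_𝔓`).  The regular curve is the `t_j`-AXIS
`C = V(t_i : i ≠ j)`; the point of its strict transform on the exceptional divisor is the prime `𝔓 ∋ u_i (i ≠ j)`; a clean component
`H = V(s)` NOT containing `C` has CONTACT `k` with `C` when `s = γ t_j^k + π`, `γ` a unit, `π ∈ (t_i : i ≠ j)`.  PROVED: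

* `isRsopPart_chartFamily_axisPoint` — at that point `(ψ t_j, (u_i)_{i≠j})` is part of a regular system of parameters of `L` (the strict
  transform `C̃ = V(u_i : i ≠ j)` is again a coordinate axis, the exceptional divisor `V(ψ t_j)` the transversal coordinate);
* `contact_step` — **the contact drops by one and the exceptional exponent grows by `a`**: in `L`,
  `ψ(u · t_j^A · s^a) = ψ(u) · ψ(t_j)^{A+a} · s₁^a` with `s₁ = ψ(γ) ψ(t_j)^{k−1} + π₁`, `π₁ ∈ (u_i : i ≠ j)` (same shape one level up);
* `isUnit_contact_zero` — when `k = 1`, `s₁` is a unit of `L` (the clean component has left the curve);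
* `cleanPermissibleAt_axis_of_monomial` — **terminal case**: if `(T, v)` is part of a regular system of parameters of a local ring `L` read in `F'`
  and a non-trivial representative is `f'(U · T^B)` with `U` a unit and `p ∤ B`, the line is `CleanPermissibleAt` for the axis ideal `(v)`.
Chaining `contact_step` `k` times and ending with `cleanPermissibleAt_axis_of_monomial` (when `p ∤ A + k a`) is phase 1 of L7b at the level of
local rings; the scheme-level identification of `𝔓` with the point of `C̃` and the phase-2 (uncharged landing) analysis are NOT here.

Honest framing: OURS, local algebra; nothing here proves resolution in characteristic `p` or any case of `CleanModels`.
-/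

noncomputable section

set_option linter.dupNamespace false -- mandated namespace of this single-conjunct summit

open IsLocalRing MvPolynomial
open Literature.AlgebraicGeometry.Resolution

namespace Summit.ResolutionOfSingularities.ResolutionOfSingularities.Theorems.RadicialJung.CleanModels

universe u

/-! ## Terminal case: a unit times a power of the transversal coordinate -/

/-- **A unit times `T^B`, `p ∤ B`, is clean-permissible for the axis `V(v)`** when `(T, v)` is part of a regular system of parameters: complete
`(T, v)` to a regular system of parameters `(T, v, y)`, take centre part `v` and transversal part `(T, y)` with exponents `(B, 0, …, 0)`. [folklore] -/
theorem cleanPermissibleAt_axis_of_monomial {L F' : Type u} [CommRing L] [IsLocalRing L] [CommRing F'] (p : ℕ) (f' : L →+* F') (G' : F')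
    (cc : Fin p → F') (hcc : ∃ j : Fin p, (j : ℕ) ≠ 0 ∧ cc j ≠ 0) {m : ℕ} (T : L) (v : Fin m → L)
    (hz : IsRsopPart (Fin.cons T v : Fin (m + 1) → L)) (U : L) (hU : IsUnit U) (B : ℕ) (hB : ¬ p ∣ B)
    (hX : (∑ j : Fin p, cc j ^ p * G' ^ (j : ℕ)) = f' (U * T ^ B)) :
    CleanPermissibleAt p f' G' (Ideal.span (Set.range v)) := by
  classical
  haveI := hz.isRegularLocalRing
  obtain ⟨e, x, hrank, hspan, hx⟩ := hz.exists_rsop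
  let y : Fin e → L := fun i => x (Fin.natAdd (m + 1) i)
  have hxsplit : x = Fin.append (Fin.cons T v : Fin (m + 1) → L) y := by
    funext i
    refine Fin.addCases (fun j => ?_) (fun k => ?_) i
    · rw [Fin.append_left, hx]
    · rw [Fin.append_right]
  have hrange : Set.range (Fin.append v (Fin.cons T y : Fin (e + 1) → L)) = Set.range x := by
    rw [hxsplit]
    ext a
    simp only [Set.mem_range]
    constructor
    · rintro ⟨i, rfl⟩
      refine Fin.addCases (fun j => ?_) (fun k => ?_) i
      · exact ⟨Fin.castAdd e (Fin.succ j), by simp⟩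
      · refine Fin.cases ?_ (fun k' => ?_) k
        · exact ⟨Fin.castAdd e 0, by simp⟩
        · exact ⟨Fin.natAdd (m + 1) k', by simp⟩
    · rintro ⟨i, rfl⟩
      refine Fin.addCases (fun j => ?_) (fun k => ?_) i
      · refine Fin.cases ?_ (fun j' => ?_) j
        · exact ⟨Fin.natAdd m 0, by simp⟩
        · exact ⟨Fin.castAdd (e + 1) j', by simp⟩
      · exact ⟨Fin.natAdd m (Fin.succ k), by simp⟩
  refine ⟨inferInstance, m, e + 1, v, Fin.cons T y, ?_, ?_, rfl, cc, hcc, Or.inl ⟨fun _ => 0, Fin.cons B (fun _ => 0), U, hU,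
    Or.inr ⟨0, by simpa using hB⟩, ?_⟩⟩
  · rw [hrange, hspan]
  · have h := IsRegularLocalRing.spanFinrank_maximalIdeal (R := L)
    rw [hrank] at h
    rw [← h]
    push_cast
    ring
  · rw [hX]
    congr 1
    rw [Fin.prod_univ_succ]
    simp

/-! ## Abstract chart data of a point blow-up, at the point of the strict transform of a coordinate axis -/

section AbstractChart

variable {R : Type u} [CommRing R] [IsRegularLocalRing R] {d : ℕ} (t : Fin d → R) (j : Fin d)
  (hspan : Ideal.span (Set.range t) = maximalIdeal R) (hdim : ringKrullDim R = (d : WithBot ℕ∞))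
  {A : Type u} [CommRing A] (ψ : R →+* A) (uA : Fin d → A)
  (hrel : ∀ i, ψ (t i) = ψ (t j) * uA i) (hnzd : ψ (t j) ∈ nonZeroDivisors A)
  (ε : MvPolynomial {i : Fin d // i ≠ j} (R ⧸ Ideal.span (Set.range t)) ≃+* A ⧸ Ideal.span {ψ (t j)})
  (hεC : ∀ r : R, ε (C (Ideal.Quotient.mk (Ideal.span (Set.range t)) r)) = Ideal.Quotient.mk _ (ψ r))
  (hεX : ∀ i : {i : Fin d // i ≠ j}, ε (X i) = Ideal.Quotient.mk _ (uA i.1))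
  (𝔓 : Ideal A) [𝔓.IsPrime] (h𝔓 : 𝔓.comap ψ = maximalIdeal R)
  (L : Type u) [CommRing L] [IsLocalRing L] [Algebra A L] [IsLocalization.AtPrime L 𝔓]
  (hC : ∀ i, i ≠ j → uA i ∈ 𝔓)

include hspan hdim hnzd hεC hεX h𝔓 hC in
/-- **At the point of the strict transform of the `t_j`-axis**, `(ψ t_j, (u_i)_{i ≠ j})` (any injective enumeration `jJ` of the `i ≠ j`) is part
of a regular system of parameters of `L` (`isRsopPart_chartFamily` with every `i ≠ j` charged). [cite: DeJong1996, 2.4] -/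
theorem isRsopPart_chartFamily_axisPoint [IsNoetherianRing A] {m : ℕ} (jJ : Fin m → {i : Fin d // i ≠ j}) (hjJ : Function.Injective jJ) :
    IsRsopPart (chartFamily t j Fin.elim0 L ψ uA jJ) :=
  isRsopPart_chartFamily t j Fin.elim0 (span_range_append_elim0 t hspan) (spanFinrank_eq_add_zero hdim) L ψ uA hnzd ε hεC hεX 𝔓 h𝔓
    jJ hjJ fun k => hC _ (jJ k).2

include hrel in
omit [IsRegularLocalRing R] in
/-- **THE CONTACT STEP.**  If `s = γ t_j^k + π` with `π ∈ (t_i : i ≠ j)` and `k ≥ 1`, then in the chart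
`ψ(s) = ψ(t_j) · s₁` with `s₁ = ψ(γ) ψ(t_j)^{k−1} + π₁`, `π₁ ∈ (u_i : i ≠ j)`, and hence
`ψ(u · t_j^A · s^a) = ψ(u) · ψ(t_j)^{A + a} · s₁^a`: the exceptional exponent grows by `a`, the contact of the strict transform of `V(s)` with the
strict transform of the axis drops by one. [cite: Piltant2013, §2 Axiom 4] -/
theorem contact_step (γ u π : R) (hπ : π ∈ Ideal.span (Set.range fun i : {i : Fin d // i ≠ j} => t i.1)) (k : ℕ) (hk : 1 ≤ k)
    (A' a : ℕ) :
    ∃ π₁ ∈ Ideal.span (Set.range fun i : {i : Fin d // i ≠ j} => uA i.1),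
      ψ (γ * t j ^ k + π) = ψ (t j) * (ψ γ * ψ (t j) ^ (k - 1) + π₁) ∧
      ψ (u * t j ^ A' * (γ * t j ^ k + π) ^ a) = ψ u * ψ (t j) ^ (A' + a) * (ψ γ * ψ (t j) ^ (k - 1) + π₁) ^ a := by
  classical
  obtain ⟨cπ, hcπ⟩ := Ideal.mem_span_range_iff_exists_fun.mp hπ
  refine ⟨∑ i, ψ (cπ i) * uA i.1, ?_, ?_, ?_⟩
  · exact Ideal.sum_mem _ fun i _ => Ideal.mul_mem_left _ _ (Ideal.subset_span ⟨i, rfl⟩)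
  · have hψπ : ψ π = ψ (t j) * ∑ i, ψ (cπ i) * uA i.1 := by
      rw [← hcπ, map_sum, Finset.mul_sum]
      refine Finset.sum_congr rfl fun i _ => ?_
      rw [map_mul, hrel i.1]
      ring
    obtain ⟨k', rfl⟩ := Nat.exists_eq_add_of_le hk
    rw [map_add, map_mul, map_pow, hψπ, Nat.add_sub_cancel_left, pow_add, pow_one]
    ring
  · have hψπ : ψ π = ψ (t j) * ∑ i, ψ (cπ i) * uA i.1 := by
      rw [← hcπ, map_sum, Finset.mul_sum]
      refine Finset.sum_congr rfl fun i _ => ?_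
      rw [map_mul, hrel i.1]
      ring
    obtain ⟨k', rfl⟩ := Nat.exists_eq_add_of_le hk
    rw [map_mul, map_mul, map_pow, map_pow, map_add, map_mul, map_pow, hψπ, Nat.add_sub_cancel_left, pow_add, pow_add, pow_one]
    rw [show ψ γ * (ψ (t j) * ψ (t j) ^ k') + ψ (t j) * ∑ i, ψ (cπ i) * uA i.1 =
        ψ (t j) * (ψ γ * ψ (t j) ^ k' + ∑ i, ψ (cπ i) * uA i.1) from by ring, mul_pow]
    ring

include h𝔓 hC in
omit [IsLocalRing L] in
/-- **Contact `0`: the clean component has left the axis.**  If `γ` is a unit and `π₁ ∈ (u_i : i ≠ j)`, then `ψ(γ) ψ(t_j)^0 + π₁` is a unit of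
`L` (its image lies in `ψ(γ) + 𝔓`). [folklore] -/
theorem isUnit_contact_zero {γ : R} (hγ : IsUnit γ) {π₁ : A}
    (hπ₁ : π₁ ∈ Ideal.span (Set.range fun i : {i : Fin d // i ≠ j} => uA i.1)) :
    IsUnit (algebraMap A L (ψ γ * ψ (t j) ^ (1 - 1) + π₁)) := by
  have hP : 𝔓.IsPrime := ‹_›
  rw [Nat.sub_self, pow_zero, mul_one]
  refine IsLocalization.map_units L (⟨ψ γ + π₁, fun h => ?_⟩ : 𝔓.primeCompl)
  have hπ𝔓 : π₁ ∈ 𝔓 := by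
    refine (Ideal.span_le.mpr ?_) hπ₁
    rintro _ ⟨i, rfl⟩
    exact hC _ i.2
  have hγ𝔓 : ψ γ ∈ 𝔓 := by simpa using 𝔓.sub_mem h hπ𝔓
  have : γ ∈ maximalIdeal R := by rw [← h𝔓]; exact hγ𝔓
  exact (IsLocalRing.mem_maximalIdeal _ |>.mp this) hγ

end AbstractChart

/-! ## The Rees chart -/

section ReesChart

variable {R : Type u} [CommRing R] [IsRegularLocalRing R] {d : ℕ} (t : Fin d → R) (j : Fin d)
  (hspan : Ideal.span (Set.range t) = maximalIdeal R) (hdim : ringKrullDim R = (d : WithBot ℕ∞))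
  (𝔴 : Ideal (chartRing t j)) [𝔴.IsPrime] (h𝔴 : 𝔴.comap (chartBase t j) = maximalIdeal R)
  (L : Type u) [CommRing L] [IsLocalRing L] (χ : chartRing t j →+* L)
  (hloc : @IsLocalization.AtPrime _ _ L _ χ.toAlgebra 𝔴 _)
  (hC : ∀ i, i ≠ j → chartGen t j i ∈ 𝔴)

include hspan hdim h𝔴 hloc hC in
/-- `isRsopPart_chartFamily_axisPoint` for the Rees chart `(R[𝔪t])_{(t_j t)}` presented by `χ`. [cite: DeJong1996, 2.4] -/
theorem isRsopPart_reesChartFamily_axisPoint {m : ℕ} (jJ : Fin m → {i : Fin d // i ≠ j}) (hjJ : Function.Injective jJ) :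
    letI := χ.toAlgebra
    IsRsopPart (chartFamily t j Fin.elim0 L (chartBase t j) (chartGen t j) jJ) := by
  letI := χ.toAlgebra
  haveI := hloc
  haveI := isNoetherianRing_blowupChart t j
  exact isRsopPart_chartFamily_axisPoint t j hspan hdim (chartBase t j) (chartGen t j) (reesChartBase_mem_nonZeroDivisors _ _)
    (chartQuotEquiv t j (isQuasiRegular_centre t Fin.elim0 (span_range_append_elim0 t hspan) (spanFinrank_eq_add_zero hdim)))
    (chartQuotMap_C t j) (chartQuotMap_X t j) 𝔴 h𝔴 L hC jJ hjJ

end ReesChart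

end Summit.ResolutionOfSingularities.ResolutionOfSingularities.Theorems.RadicialJung.CleanModels

end
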